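import Summits.BirchSwinnertonDyer.BirchSwinnertonDyer.Theorems.PrintCFramBottomClassIndexLawFiveLeBorelNoPTorsion
import Summits.BirchSwinnertonDyer.BirchSwinnertonDyer.Theorems.PrintCFramBottomClassIndexLawFiveLeRationalPIsogeny
import Summits.BirchSwinnertonDyer.BirchSwinnertonDyer.Theorems.PrintCFramBottomClassIndexLawFiveLeIsogenyLineData
import Literature.NumberTheory.EllipticCurves.SerreOpenImageDeterminantProofs
import HarnessLib

/-!
# Route `PrintCFram`, crux C2 `BottomClassIndexLawFiveLe` (stmt-BirchSwinnertonDyer-20372), line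
# `eisenstein-resource-bdp-line` (S2 `stub_kolyvaginUpper_borelCM`, visibility step (γ)): the SIGN OF
# COMPLEX CONJUGATION ON THE RATIONAL LINE FLIPS ALONG THE `p`-ISOGENY — for any elliptic `W/ℚ` with a
# `ℚ`-isogeny `g : W → W₁` of prime degree `p`, the characters of `Γ_ℚ` on `ker g ⊂ W[p]` and on the
# image line `g(W[p]) ⊂ W₁[p]` multiply to `χ̄_p`; so an involution with `χ̄_p = −1` (complex
# conjugation) acts on the two lines by opposite signs
# (cell `bsd-print-cfram`, seat `bsd-line-cfram-p1-w2` g5; helper `--supports` 20372; 0 facts, 0 defs)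

HONEST FRAMING. Nothing about BSD is proved here, and nothing of S2. This is the kernel form of one
sentence of the line's visibility analysis (crux workfile `Lines/borel-heegner-squeeze-H1check.md` §3):
«`η_line(W ⊗ ε_K) = −η_line(W)` — the parity switch IS the isogeny switch»: at a Kolyvagin prime the
Selmer classes valued in the bottom line `W[𝔭]` of the wrong sign `−η_line(W)` are invisible, and
passing to the `p`-isogenous curve `W₁ = W/W[𝔭]` flips the sign.

* §1 `exists_scalar_quot_of_isRationalLine` — for a rational line `Φ ≤ W[p]` and `σ ∈ Γ_ℚ`: integers
  `a, d` with `σ = a` on `Φ`, `σ ≡ d` on `W[p]/Φ`, and **`a·d ≡ χ̄_p(σ)`** (Weil pairing, tree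
  `EisensteinPrimesMuLambda.det_eq_mul_of_smul_eq_of_smul_sub_mem`).
* §2 `exists_lines_of_isogeny` — for a `ℚ`-isogeny `g : W → W₁` with `#ker g = p`: rational lines
  `Φ = ker g ≤ W[p]` and `Φ₁ = g(W[p]) ≤ W₁[p]`, and for every `σ ∈ Γ_ℚ` scalars `a` on `Φ`, `d` on `Φ₁`
  with `a·d ≡ χ̄_p(σ)`; `smul_line_eq_neg_of_isogeny` — if `σ² = 1` and `χ̄_p(σ) = −1` then
  `a ≡ ±1` and **`d ≡ −a`**.
* §3 `exists_lines_sign_flip_of_cmRamified` — on the leaf (`W.HasCM`, `CMRamified W p`, `5 ≤ p`):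
  with the certified `p`-isogeny `W → W₁` (`RationalPIsogeny.exists_rational_pIsogeny_of_cmRamified`,
  `W₁` globally minimal, `j(W₁) = j(W)`) and an involution `c ∈ Γ_ℚ` with `χ̄_p(c) = −1`
  (`exists_sq_eq_one_modPCyclotomicCharacterZMod_eq_neg_one`): `c` acts on `W`'s line by `a ≡ ±1`
  and on `W₁`'s line by `−a`. So every `ℚ`-isogeny class of the leaf contains members of BOTH signs.

THEOREMS ONLY; no definition, no named fact, no `sorry`; imports no `Theses` module. BSD is not
proved by any of this; no summit statement is proved by this seat.
References: [GrossLMS1991] §9 Prop. 9.1–9.3 (the visibility mechanism); [SilvermanCSS1997] Ch. II §7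
(det ρ̄ = χ̄); [GreenbergVatsal2000] §2 p. 28 (the lines Φ, Ψ).
-/

set_option autoImplicit false
-- `…BirchSwinnertonDyer.BirchSwinnertonDyer.Theorems…` is the problem's mandated namespace (D-0017).
set_option linter.dupNamespace false

noncomputable section

open scoped Classical

namespace Summit.BirchSwinnertonDyer.BirchSwinnertonDyer.Theorems.PrintCFram.BorelHomothety

open WeierstrassCurve Field Literature.NumberTheory.EllipticCurves
  Literature.NumberTheory.GaloisRepresentations Literature.NumberTheory.EllipticCurves.Rank1Residual
  Summit.BirchSwinnertonDyer.BirchSwinnertonDyer.Theorems.PrintCFram.LineCharacter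
  Summit.BirchSwinnertonDyer.BirchSwinnertonDyer.Theorems.EisensteinPrimesMuLambda

/-! ## §1 A rational line: scalars on the line and on the quotient, and their product -/

section Line

variable (W : WeierstrassCurve ℚ) [W.IsElliptic] (p : ℕ) [hp : Fact p.Prime]

/-- **Scalars on a rational line and on its quotient; `a·d = χ̄_p(σ)`.** For a `Γ_ℚ`-stable line
`Φ ≤ W[p]` of order `p` and `σ ∈ Γ_ℚ` there are integers `a, d` with `σ P = a P` on `Φ`,
`σ Q − d Q ∈ Φ` for all `Q ∈ W[p]`, and `a·d ≡ χ̄_p(σ) (mod p)` (determinant on an adapted basis,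
Weil pairing). [cite: SilvermanCSS1997, Ch. II §7 Proposition (det ρ̄_m = χ_m)] [cite: GreenbergVatsal2000, §2 p. 28] -/
theorem exists_scalar_quot_of_isRationalLine {Φ : AddSubgroup (W.geomTorsion (p : ℤ))}
    (hΦ : IsRationalLine W p Φ) (σ : absoluteGaloisGroup ℚ) :
    ∃ a d : ℤ, (∀ P ∈ Φ, σ • P = a • P) ∧ (∀ Q : W.geomTorsion (p : ℤ), σ • Q - d • Q ∈ Φ) ∧
      ((a * d : ℤ) : ZMod p) = ((modPCyclotomicCharacterZMod ℚ p σ : (ZMod p)ˣ) : ZMod p) := by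
  have hpr : p.Prime := hp.out
  haveI : NeZero (p : ℚ) := ⟨Nat.cast_ne_zero.mpr hpr.ne_zero⟩
  -- a generator `P` of `Φ`, the scalar `a`
  obtain ⟨P, hP, hP0⟩ := exists_ne_zero_of_card_eq_prime hpr hΦ.1
  have hzm : Φ = AddSubgroup.zmultiples P := eq_zmultiples_of_card_eq_prime hpr hΦ.1 hP hP0
  obtain ⟨a, ha⟩ : ∃ a : ℤ, a • P = σ • P := by
    have h := hΦ.2 σ P hP
    rw [hzm, AddSubgroup.mem_zmultiples_iff] at h
    exact h
  have hline : ∀ P' ∈ Φ, σ • P' = a • P' := by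
    intro P' hP'
    rw [hzm, AddSubgroup.mem_zmultiples_iff] at hP'
    obtain ⟨k, rfl⟩ := hP'
    rw [smul_comm σ k P, ← ha, smul_comm k a P]
  -- a vector `S ∉ Φ` and the scalar `d` on the quotient (cyclic of order `p`)
  haveI : Finite (W.geomTorsion (p : ℤ)) :=
    finite_torsionPoints_holds W (AlgebraicClosure ℚ) (by exact_mod_cast hpr.ne_zero)
  have hlt : Nat.card Φ < Nat.card (W.geomTorsion (p : ℤ)) := by
    rw [hΦ.1, W.natCard_geomTorsion_prime_eq_sq hpr, sq]
    exact lt_mul_self hpr.one_lt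
  obtain ⟨S, hS⟩ : ∃ S : W.geomTorsion (p : ℤ), S ∉ Φ := by
    by_contra h
    simp only [not_exists, not_not] at h
    have htop : Φ = ⊤ := (AddSubgroup.eq_top_iff' Φ).mpr h
    rw [htop, AddSubgroup.card_top] at hlt
    exact lt_irrefl _ hlt
  have hcardQ : Nat.card (W.geomTorsion (p : ℤ) ⧸ Φ) = p := by
    have h := Φ.card_eq_card_quotient_mul_card_addSubgroup
    rw [W.natCard_geomTorsion_prime_eq_sq hpr, hΦ.1, sq] at h
    exact (Nat.eq_of_mul_eq_mul_right hpr.pos h).symm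
  have hS0 : (QuotientAddGroup.mk S : W.geomTorsion (p : ℤ) ⧸ Φ) ≠ 0 := by
    intro h0
    exact hS ((QuotientAddGroup.eq_zero_iff S).mp h0)
  have htop : (⊤ : AddSubgroup (W.geomTorsion (p : ℤ) ⧸ Φ)) =
      AddSubgroup.zmultiples (QuotientAddGroup.mk S) :=
    eq_zmultiples_of_card_eq_prime hpr (by rw [AddSubgroup.card_top, hcardQ]) (AddSubgroup.mem_top _) hS0
  obtain ⟨d, hd⟩ : ∃ d : ℤ, d • (QuotientAddGroup.mk S : W.geomTorsion (p : ℤ) ⧸ Φ) =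
      QuotientAddGroup.mk (σ • S) := by
    have h := AddSubgroup.mem_top (QuotientAddGroup.mk (σ • S) : W.geomTorsion (p : ℤ) ⧸ Φ)
    rw [htop, AddSubgroup.mem_zmultiples_iff] at h
    exact h
  have hdS : σ • S - d • S ∈ Φ := by
    rw [← QuotientAddGroup.eq_zero_iff, QuotientAddGroup.mk_sub, QuotientAddGroup.mk_zsmul, ← hd,
      sub_self]
  have hquot : ∀ Q : W.geomTorsion (p : ℤ), σ • Q - d • Q ∈ Φ := by
    intro Q
    obtain ⟨k, hk⟩ : ∃ k : ℤ, k • (QuotientAddGroup.mk S : W.geomTorsion (p : ℤ) ⧸ Φ) =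
        QuotientAddGroup.mk Q := by
      have h := AddSubgroup.mem_top (QuotientAddGroup.mk Q : W.geomTorsion (p : ℤ) ⧸ Φ)
      rw [htop, AddSubgroup.mem_zmultiples_iff] at h
      exact h
    have hQS : Q - k • S ∈ Φ := by
      rw [← QuotientAddGroup.eq_zero_iff, QuotientAddGroup.mk_sub, QuotientAddGroup.mk_zsmul, ← hk,
        sub_self]
    have h1 : σ • (Q - k • S) - a • (Q - k • S) ∈ Φ := by
      rw [hline _ hQS, sub_self]; exact zero_mem Φ
    have h2 : σ • Q - d • Q = (σ • (Q - k • S) - a • (Q - k • S)) + (a - d) • (Q - k • S) +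
        k • (σ • S - d • S) := by
      rw [smul_sub σ Q (k • S), smul_comm σ k S]
      generalize σ • Q = X
      generalize σ • S = Y
      module
    rw [h2]
    exact Φ.add_mem (Φ.add_mem h1 (Φ.zsmul_mem hQS _)) (Φ.zsmul_mem hdS _)
  refine ⟨a, d, hline, hquot, ?_⟩
  rw [hzm] at hS hdS
  exact det_eq_mul_of_smul_eq_of_smul_sub_mem W p hP0 σ (hline P hP) hS hdS

end Line

/-! ## §2 A `ℚ`-isogeny of degree `p`: the kernel line, the image line, and the product formula -/

section Isogeny

variable (W W₁ : WeierstrassCurve ℚ) [W.IsElliptic] [W₁.IsElliptic] (p : ℕ) [hp : Fact p.Prime]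
  (g : Isogeny W W₁)

omit [W₁.IsElliptic] in
/-- **The two lines of a `p`-isogeny and the product formula.** For a `ℚ`-isogeny `g : W → W₁` with
`#ker g = p`: the kernel line `Φ ≤ W[p]` and the image line `Φ₁ = g(W[p]) ≤ W₁[p]` are `Γ_ℚ`-stable of
order `p`, and for every `σ ∈ Γ_ℚ` there are integers `a, d` with `σ = a` on `Φ`, `σ = d` on `Φ₁` and
`a·d ≡ χ̄_p(σ) (mod p)`. [cite: GreenbergVatsal2000, §2 p. 28 (the lines Φ and Ψ = E[p]/Φ)]
[cite: SilvermanCSS1997, Ch. II §7 Proposition (det ρ̄_m = χ_m)] -/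
theorem exists_lines_of_isogeny (hg : g.degree = p) :
    ∃ (Φ : AddSubgroup (W.geomTorsion (p : ℤ))) (Φ₁ : AddSubgroup (W₁.geomTorsion (p : ℤ))),
      IsRationalLine W p Φ ∧ IsRationalLine W₁ p Φ₁ ∧
      (∀ P : W.geomTorsion (p : ℤ), P ∈ Φ ↔ g (P : W.geomPoints) = 0) ∧
      (∀ Q : W.geomTorsion (p : ℤ), ∃ R ∈ Φ₁, (R : W₁.geomPoints) = g (Q : W.geomPoints)) ∧
      ∀ σ : absoluteGaloisGroup ℚ, ∃ a d : ℤ, (∀ P ∈ Φ, σ • P = a • P) ∧ (∀ R ∈ Φ₁, σ • R = d • R) ∧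
        ((a * d : ℤ) : ZMod p) = ((modPCyclotomicCharacterZMod ℚ p σ : (ZMod p)ˣ) : ZMod p) := by
  have hpr : p.Prime := hp.out
  -- `g` on `p`-torsion
  have hmem : ∀ Q : W.geomTorsion (p : ℤ), g (Q : W.geomPoints) ∈ W₁.geomTorsion (p : ℤ) := by
    intro Q
    rw [AddSubgroup.torsionBy.nsmul_iff, ← map_nsmul, AddSubgroup.torsionBy.nsmul_iff.mp Q.2, map_zero]
  set gT : W.geomTorsion (p : ℤ) →+ W₁.geomTorsion (p : ℤ) :=
    { toFun := fun Q => ⟨g Q, hmem Q⟩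
      map_zero' := Subtype.ext (by simp)
      map_add' := fun P Q => Subtype.ext (by simp) } with hgT_def
  have hgT : ∀ Q : W.geomTorsion (p : ℤ), ((gT Q : W₁.geomTorsion (p : ℤ)) : W₁.geomPoints) = g Q :=
    fun Q => rfl
  have hgTσ : ∀ (σ : absoluteGaloisGroup ℚ) (Q : W.geomTorsion (p : ℤ)), gT (σ • Q) = σ • gT Q :=
    fun σ Q => Subtype.ext (g.map_smul σ Q)
  -- the kernel line
  set Φ : AddSubgroup (W.geomTorsion (p : ℤ)) := gT.ker with hΦ_def
  have hΦmem : ∀ P : W.geomTorsion (p : ℤ), P ∈ Φ ↔ g (P : W.geomPoints) = 0 := by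
    intro P
    rw [hΦ_def, AddMonoidHom.mem_ker]
    exact ⟨fun h => by rw [← hgT, h]; rfl, fun h => Subtype.ext h⟩
  have hΦcard : Nat.card Φ = p := by
    have hc : Nat.card Φ = Nat.card g.toAddMonoidHom.ker := Nat.card_congr
      { toFun := fun P => ⟨(P.1 : W.geomPoints), (hΦmem P.1).mp P.2⟩
        invFun := fun Q => ⟨⟨Q.1, PrintCFram.IsogenyLineData.ker_le_geomTorsion g hg Q.2⟩,
          (hΦmem _).mpr Q.2⟩
        left_inv := fun P => rfl
        right_inv := fun Q => rfl }
    rw [hc]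
    exact hg
  have hΦstab : ∀ σ : absoluteGaloisGroup ℚ, ∀ P ∈ Φ, σ • P ∈ Φ := by
    intro σ P hP
    rw [hΦ_def, AddMonoidHom.mem_ker] at hP ⊢
    rw [hgTσ, hP, smul_zero]
  have hΦ : IsRationalLine W p Φ := ⟨hΦcard, hΦstab⟩
  -- the image line
  set Φ₁ : AddSubgroup (W₁.geomTorsion (p : ℤ)) := gT.range with hΦ₁_def
  haveI : Finite (W.geomTorsion (p : ℤ)) :=
    finite_torsionPoints_holds W (AlgebraicClosure ℚ) (by exact_mod_cast hpr.ne_zero)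
  have hΦ₁card : Nat.card Φ₁ = p := by
    have h1 : Nat.card (W.geomTorsion (p : ℤ) ⧸ gT.ker) = Nat.card Φ₁ :=
      Nat.card_congr (QuotientAddGroup.quotientKerEquivRange gT).toEquiv
    have h2 := gT.ker.card_eq_card_quotient_mul_card_addSubgroup
    rw [W.natCard_geomTorsion_prime_eq_sq hpr, h1, ← hΦ_def, hΦcard, sq] at h2
    exact (Nat.eq_of_mul_eq_mul_right hpr.pos h2).symm
  have hΦ₁stab : ∀ σ : absoluteGaloisGroup ℚ, ∀ R ∈ Φ₁, σ • R ∈ Φ₁ := by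
    rintro σ _ ⟨Q, rfl⟩
    exact ⟨σ • Q, hgTσ σ Q⟩
  refine ⟨Φ, Φ₁, hΦ, ⟨hΦ₁card, hΦ₁stab⟩, hΦmem, fun Q => ⟨gT Q, ⟨Q, rfl⟩, hgT Q⟩, fun σ => ?_⟩
  obtain ⟨a, d, ha, hd, had⟩ := exists_scalar_quot_of_isRationalLine W p hΦ σ
  refine ⟨a, d, ha, ?_, had⟩
  rintro _ ⟨Q, rfl⟩
  have h0 : gT (σ • Q - d • Q) = 0 := (gT.mem_ker).mp (hd Q)
  rw [map_sub, hgTσ, map_zsmul, sub_eq_zero] at h0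
  exact h0

omit [W.IsElliptic] in
/-- **The sign flips along the isogeny.** With `Φ, Φ₁` as in `exists_lines_of_isogeny`: if
`σ ∈ Γ_ℚ` is an involution with `χ̄_p(σ) = −1` (a complex conjugation), acting on `Φ` by `a` and on
`Φ₁` by `d`, then `a² ≡ 1` and `d ≡ −a (mod p)`: the kernel line of `W` and the image line in `W₁`
are `σ`-eigenlines of OPPOSITE signs. [cite: GrossLMS1991, §9 (the τ-eigenspaces E_p^±)] -/
theorem smul_line_eq_neg_of_isogeny {Φ : AddSubgroup (W.geomTorsion (p : ℤ))} (hΦ : IsRationalLine W p Φ)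
    {σ : absoluteGaloisGroup ℚ} (hσ : σ * σ = 1)
    (hχ : ((modPCyclotomicCharacterZMod ℚ p σ : (ZMod p)ˣ) : ZMod p) = -1) {a d : ℤ}
    (ha : ∀ P ∈ Φ, σ • P = a • P)
    (had : ((a * d : ℤ) : ZMod p) = ((modPCyclotomicCharacterZMod ℚ p σ : (ZMod p)ˣ) : ZMod p)) :
    ((a : ℤ) : ZMod p) ^ 2 = 1 ∧ ((d : ℤ) : ZMod p) = -(a : ZMod p) := by
  have hpr : p.Prime := hp.out
  haveI : NeZero p := ⟨hpr.ne_zero⟩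
  -- `a² ≡ 1`: `σ² = 1` on a non-zero `P ∈ Φ`
  obtain ⟨P, hP, hP0⟩ := exists_ne_zero_of_card_eq_prime hpr hΦ.1
  have haa : (a * a) • P = P := by
    rw [mul_smul, ← ha P hP, smul_comm a σ P, ← ha P hP, ← mul_smul, hσ, one_smul]
  have hsq : ((a : ℤ) : ZMod p) ^ 2 = 1 := by
    have h1 : (a * a - 1) • P = 0 := by rw [sub_smul, one_smul, haa, sub_self]
    have hdvd : (p : ℤ) ∣ a * a - 1 := by
      by_contra hnd
      have hcop : IsCoprime (a * a - 1) (p : ℤ) :=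
        ((Irreducible.coprime_iff_not_dvd (Nat.prime_iff_prime_int.mp hpr).irreducible).mpr hnd).symm
      obtain ⟨u, v, huv⟩ := hcop
      apply hP0
      have hpP : (p : ℤ) • P = 0 := by
        rw [natCast_zsmul]; exact AddSubgroup.torsionBy.nsmul P
      calc P = (1 : ℤ) • P := (one_smul ℤ P).symm
        _ = (u * (a * a - 1) + v * p) • P := by rw [huv]
        _ = 0 := by rw [add_smul, mul_smul, mul_smul, h1, hpP, smul_zero, smul_zero, add_zero]
    have h2 : ((a * a - 1 : ℤ) : ZMod p) = 0 := (ZMod.intCast_zmod_eq_zero_iff_dvd _ p).mpr hdvd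
    rw [Int.cast_sub, Int.cast_mul, Int.cast_one, sub_eq_zero] at h2
    rw [sq, h2]
  refine ⟨hsq, ?_⟩
  -- `a d = -1` and `a² = 1` give `d = -a`
  rw [hχ, Int.cast_mul] at had
  have : ((d : ℤ) : ZMod p) = (a : ZMod p) ^ 2 * (d : ZMod p) := by rw [hsq, one_mul]
  rw [this, sq, mul_assoc, had, mul_neg, mul_one]

end Isogeny

/-! ## §3 On the leaf: every `ℚ`-isogeny class carries both signs -/

section Leaf

variable (W : WeierstrassCurve ℚ) [W.IsElliptic] (p : ℕ) [hp : Fact p.Prime]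

/-- **Both visibility signs occur in each isogeny class of the leaf.** For `W/ℚ` with CM and `p ≥ 5`
ramified in the CM field: there are the `p`-isogenous globally minimal `W₁` (`j(W₁) = j(W)`), the
rational lines `Φ ≤ W[p]`, `Φ₁ ≤ W₁[p]`, and an involution `c ∈ Γ_ℚ` with `χ̄_p(c) = −1` acting on
`Φ` by an integer `a` with `a² ≡ 1` and on `Φ₁` by an integer `d ≡ −a (mod p)`.
[cite: GrossLMS1991, §9 (τ-eigenspaces)] [cite: SilvermanATAEC1994, App. A §3] -/
theorem exists_lines_sign_flip_of_cmRamified (hCM : W.HasCM) (h5 : 5 ≤ p) (hram : CMRamified W p) :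
    ∃ (W₁ : WeierstrassCurve ℚ) (_ : W₁.IsElliptic) (_ : W₁.IsGloballyMinimal) (g : Isogeny W W₁)
      (Φ : AddSubgroup (W.geomTorsion (p : ℤ))) (Φ₁ : AddSubgroup (W₁.geomTorsion (p : ℤ)))
      (c : absoluteGaloisGroup ℚ) (a d : ℤ),
      W₁.j = W.j ∧ g.degree = p ∧ IsRationalLine W p Φ ∧ IsRationalLine W₁ p Φ₁ ∧
      (∀ P : W.geomTorsion (p : ℤ), P ∈ Φ ↔ g (P : W.geomPoints) = 0) ∧
      (∀ Q : W.geomTorsion (p : ℤ), ∃ R ∈ Φ₁, (R : W₁.geomPoints) = g (Q : W.geomPoints)) ∧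
      c * c = 1 ∧ ((modPCyclotomicCharacterZMod ℚ p c : (ZMod p)ˣ) : ZMod p) = -1 ∧
      (∀ P ∈ Φ, c • P = a • P) ∧ (∀ R ∈ Φ₁, c • R = d • R) ∧
      ((a : ℤ) : ZMod p) ^ 2 = 1 ∧ ((d : ℤ) : ZMod p) = -(a : ZMod p) := by
  have hpr : p.Prime := hp.out
  haveI : NeZero (p : ℚ) := ⟨Nat.cast_ne_zero.mpr hpr.ne_zero⟩
  obtain ⟨W₁, _, _, hj, g, hg⟩ :=
    PrintCFram.RationalPIsogeny.exists_rational_pIsogeny_of_cmRamified W p hCM h5 hram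
  obtain ⟨Φ, Φ₁, hΦ, hΦ₁, hker, him, hσ⟩ := exists_lines_of_isogeny W W₁ p g hg
  obtain ⟨c, hc2, hcχ⟩ := exists_sq_eq_one_modPCyclotomicCharacterZMod_eq_neg_one p
  obtain ⟨a, d, ha, hd, had⟩ := hσ c
  have hcc : c * c = 1 := by rw [← sq]; exact hc2
  obtain ⟨hsq, hneg⟩ := smul_line_eq_neg_of_isogeny W p hΦ hcc hcχ ha had
  exact ⟨W₁, ‹_›, ‹_›, g, Φ, Φ₁, c, a, d, hj, hg, hΦ, hΦ₁, hker, him, hcc, hcχ, ha, hd, hsq, hneg⟩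

end Leaf

end Summit.BirchSwinnertonDyer.BirchSwinnertonDyer.Theorems.PrintCFram.BorelHomothety

end
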